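import Summits.QuantumFields.YangMills.Theorems.BalabanUVNodesN11TStepOldBranchInnerSumAtRePinH

/-!
# DAG node N11 — THE (O3′) CLAUSE AT A 𝐓-PRESENT CHILD OF THE WITNESS CHAIN, IN THE CHAIN's OWN CURRENCY: from `θ.Provisos₁₃CoPH`, `ChainFormAt θ p σ k` (Theorem 1's inductive
# hypothesis), `SupplierTermRows θ p σ` (dag-n11-w3), the residual-measurability rows — GONE at `rePinH θ` — and the per-old-branch chart-side data `Fᵢ₀ ∕ hFm₀ ∕ hin₀ ∕ hinner₀`

HEADER — WORK-UNIT METADATA.  Cell `pub-ymgap`, YM-PLAN Track A (HUMAN RULING D-0062 ∕ D-0149), width seat `pub-ymgap-dag-n11-w2` (g4; WIDTH SEAT 2∕4 on N11 [B14]),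
route `BalabanUVNodes`; this seat's jail key is K1⁷ `stmt-QuantumFields-20542` (`--kind proof --supports 20542 --as helper`, count-neutral); the K1 face of record since
KEY MAP v2 is K1⁹ `StabilityBRunRowsAtRecordR13SepCoPHV` = stmt-QuantumFields-27364 (MIS-KEY ∕ VALID rule R463 (4)(a): lineage BY NAME).  [III] = [Balaban1988Convergent].
Sequel of this seat's `…OperandRowAtHistoryOfTermRows` (§3, `termRowsAt_graftAboveB`) and `…TStepOldBranchInnerSumAtRePinH` (§2), over dag-n11-e's `…Sect3SupplyChainDefs` ∕
`…ObligationsDefs` (`Sect3Supplier`, `chainWitness`, `ChainFormAt`, `PresentChildObligations`) and dag-n11-w3's `…Sect3SupplyChainTermRows` (`SupplierTermRows`,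
`termRowsAt_chainWitness_of_supplierTermRows`).  Bus: CLAIM-8 of g4.

WHY THIS FILE.  dag-n11-e's chain road displays `hpres : ∀ k < K, ChainFormAt θ p σ k → ∀ 𝐓-present child s′, PresentChildObligations θ p k (chainWitness k).1 (σ k …).1 (σ k …).2 s′`
— the SUPPLIER's content.  For the (O3′) conjunct of `PresentChildObligations` (the 𝐓-image identity (3.24)–(3.25) for the graft of the chain's level-`k` witness with the supplier's
response), this seat's files reduced every bookkeeping row to named currencies.  THIS FILE states the result IN THE CHAIN's OWN LETTERS: a supplier `σ` with dag-n11-w3's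
`SupplierTermRows θ p σ` (a property of its own terms; the chain witness then has the term rows at the levels `1 … k` — `termRowsAt_chainWitness_of_supplierTermRows` — and the
response at every level `1 ≤ j`), holding Theorem 1's inductive hypothesis `ChainFormAt θ p σ k`, meets (O3′) at the child `s′` as soon as it produces the per-old-branch
chart-side data `Fᵢ₀ ∕ hFm₀ ∕ hin₀` and THE integral identity `hinner₀` for ITS OWN new operand `e^{A_{k+1}(s′; graftAboveB k (chainWitness k).1(init s′) (σ k …).1(s′), (σ k …).2(s′), U_{k+1})}`
(and, at a generic `θ`, the four residual-measurability rows; at `rePinH θ` nothing else).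

WHAT THIS FILE PROVES (0 `sorry`, 0 `def`, standard axioms).
★★★★★★ `O3_presentChild_of_chainFormAt_of_supplierTermRows` (generic `θ`) · ★★★★★★ `O3_presentChild_rePinH_of_chainFormAt_of_supplierTermRows` (AT `rePinH θ`: residual rows GONE).
Both conclude LITERALLY the last conjunct of `PresentChildObligations θ p k (chainWitness θ p σ k).1 (σ k (chainWitness θ p σ k).1 (chainWitness θ p σ k).2).1
(σ k (chainWitness θ p σ k).1 (chainWitness θ p σ k).2).2 s′`.

HONEST FRAMING.  Helper lane, count-neutral; ONE composition each, BY NAME; `ChainFormAt`, `SupplierTermRows` and every chart-side hypothesis DISPLAYED — `hinner₀` is where [I] §2 ∕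
[III] §3 ∕ Thm 2 live, NOT proved here; no supplier is constructed; NO chart of Bałaban's, NO Jacobian, NO Gaussian integration asserted; (B4) ∕ (S-α) ∕ (O3′) NOT closed; N11 NOT
discharged; K1⁹ NOT closed, no registered stub touched; counts unmoved (typed 28∕28 · discharged 5∕27 · A 5∕28).  One finite `𝕋⁴_{L^K}` programme at fixed `ε = L^{−K}`; R4 closes
only the conditional finite-𝕋⁴ rung `BalabanLadder.UV` — NOT ℝ⁴, NOT OS, NOT a mass gap, NOT Clay.  No `sorry`, `axiom`, `def`, `instance`, `notation`.  Sources (SHAPE ∕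
bookkeeping only): [III] Thm 1 p.262, Thm 2 p.263, §3 p.279, (3.24)–(3.25) p.270, (3.1) p.264, (2.18) p.257, (2.20)–(2.23) p.258, (2.40)–(2.41) p.261; [Balaban1989LargeFieldI] (0.2)–(0.3) p.176.
-/

noncomputable section

open MeasureTheory ProbabilityTheory
open scoped ENNReal NNReal BigOperators Matrix.Norms.L2Operator

namespace Summit.QuantumFields.YangMills.Theorems.BalabanUVNodesN11O3OfSupplierTermRows

open Literature.MathematicalPhysics.QuantumFieldTheory.Balaban1983to89
open Literature.MathematicalPhysics.QuantumFieldTheory.Balaban1983to89.T4AveragingDisintegration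
open BalabanUVNodesN11OperandRowAtHistoryOfTermRows (slotsTOfRecord₁₃H_succ_O3_of_hasSect2FormAtZS_of_oldBranchInnerSum_of_provisos_of_termRows termRowsAt_graftAboveB)
open BalabanUVNodesN11TStepOldBranchInnerSumAtRePinH (slotsTOfRecord₁₃H_succ_O3_of_hasSect2FormAtZS_of_oldBranchInnerSum_rePinH_of_termRows)
open BalabanUVNodesN11Sect3SupplySpliceOwnBoundary (graftAboveB)
open BalabanUVNodesN11Sect3SupplyChainDefs (Sect3Supplier chainWitness)
open BalabanUVNodesN11Sect3SupplyChainObligationsDefs (ChainFormAt)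
open BalabanUVNodesN11Sect3SupplyChainTermRows (SupplierTermRows termRowsAt_chainWitness_of_supplierTermRows)
open BalabanUVNodesN11RePinnedParamDefs (rePinH)
open Node00 hiding SU
open Node00.Tk T4Continuum B14.Eq218Concrete
open B10Eq42TorusConstraint (bondsIn)

variable {F : T4Family} {N : ℕ} [NeZero N]

/-! ## §1  Generic `θ` -/

/-- ★★★★★★ **THE (O3′) CLAUSE AT A 𝐓-PRESENT CHILD OF THE CHAIN, FROM THE SUPPLIER's TERM ROWS** (generic `θ`): for a supplier `σ` with `SupplierTermRows θ p σ`, Theorem 1's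
inductive hypothesis `ChainFormAt θ p σ k` (`k < K`) and a child `s′` of length `k+1`, the last conjunct of `PresentChildObligations θ p k (chainWitness θ p σ k).1 (σ k …).1 (σ k …).2 s′`
follows from `θ.Provisos₁₃CoPH F N`, the four residual-measurability rows, and the per-old-branch chart-side data `Fᵢ₀ ∕ hFm₀ ∕ hin₀ ∕ hinner₀` for the graft's operand.
`…OperandRowAtHistoryOfTermRows` §3 with the term rows of the chain witness (`termRowsAt_chainWitness_of_supplierTermRows`, levels `1 … k`) and of the graft
(`termRowsAt_graftAboveB`; the response's rows at every level `1 ≤ j` are `SupplierTermRows` itself).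
[cite: Balaban1988Convergent, Thm 1 p.262, Thm 2 p.263, §3 p.279, (3.24)–(3.25) p.270, (2.40)–(2.41) p.261] -/
theorem O3_presentChild_of_chainFormAt_of_supplierTermRows (θ : Stage13HParams F N) (h : θ.Provisos₁₃CoPH F N)
    (p : B12.RunParams) {k : ℕ} (hkK : k < p.K)
    {hdec : DecidableEq (PBond (F.P p.K) k)} {hdec' : DecidableEq (PBond (F.P p.K) (k + 1))} (hk : k + 1 ≤ (F.P p.K).m + (F.P p.K).K)
    -- the supplier, Theorem 1's level-`k` form of its chain (dag-n11-e's `ChainFormAt`), its term rows (dag-n11-w3's `SupplierTermRows`), the child `s′`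
    (σ : Sect3Supplier θ p) (hform : ChainFormAt θ p σ k) (hσ : SupplierTermRows θ p σ)
    (s' : SeqOfRecord F θ.ν θ.τ9.M (gOfRecord₁₃ F N θ.toStage13Params p) p.K (k + 1))
    -- measurability of the residuals serving `init s′` and `s′` (dag-n11-e's `ResidualRowsAt` shapes)
    (hζ0m : ∀ j Y, Measurable ((θ.zhAt p s'.init).ζ0 j Y)) (hqm : ∀ j Λ', Measurable ((θ.zhAt p s'.init).quad j Λ'))
    (hζm : ∀ j Y, Measurable ((θ.zhAt p s').ζ0 j Y)) (hqm' : ∀ j Λ', Measurable ((θ.zhAt p s').quad j Λ'))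
    (Fᵢ₀ : (ℕ → Set (Site (F.P p.K) 0)) → (↥(Set.toFinite (bondsIn k (s'.Ω (k + 1))ᶜ)).toFinset → SU N) ×
        ({c : PBond (F.P p.K) (k + 1) // c ∉ (Set.toFinite (bondsIn (k + 1) (s'.Ω (k + 1))ᶜ)).toFinset} → SU N) → ℝ)
    (hFm₀ : ∀ S₀ ∈ admSOfRecord F θ.ν θ.τ9.M (gOfRecord₁₃ F N θ.toStage13Params p) p.K k s'.init, Measurable (Fᵢ₀ S₀))
    (hin₀ : ∀ S₀ ∈ admSOfRecord F θ.ν θ.τ9.M (gOfRecord₁₃ F N θ.toStage13Params p) p.K k s'.init, kernelTransport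
        ((Measure.pi fun _ : ↥(Set.toFinite (bondsIn k (s'.Ω (k + 1))ᶜ)).toFinset => (HaarData.haar : Measure (SU N))).prod
          (Measure.pi fun _ : {b : PBond (F.P p.K) k // b ∉ (Set.toFinite (bondsIn k (s'.Ω (k + 1))ᶜ)).toFinset} => (HaarData.haar : Measure (SU N))))
        ((Measure.pi fun _ : ↥(Set.toFinite (bondsIn k (s'.Ω (k + 1))ᶜ)).toFinset => (HaarData.haar : Measure (SU N))).prod
          (Measure.pi fun _ : {c : PBond (F.P p.K) (k + 1) // c ∉ (Set.toFinite (bondsIn (k + 1) (s'.Ω (k + 1))ᶜ)).toFinset} =>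
            (HaarData.haar : Measure (SU N))))
        (fun q => (q.1, fun c : {c : PBond (F.P p.K) (k + 1) // c ∉ (Set.toFinite (bondsIn (k + 1) (s'.Ω (k + 1))ᶜ)).toFinset} =>
          (avOfRecord F N p.K k).avg
            ((MeasurableEquiv.piEquivPiSubtypeProd (fun _ : PBond (F.P p.K) k => SU N)
              (· ∈ (Set.toFinite (bondsIn k (s'.Ω (k + 1))ᶜ)).toFinset)).symm q) c))
        ((fun U => wOfRecord₉ F N θ.toStage9Params p (gOfRecord₁₃ F N θ.toStage13Params p) k s' U ((avOfRecord F N p.K k).avg U) *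
            (chiSeqOfRecord F N θ.ν θ.τ9.M (gOfRecord₁₃ F N θ.toStage13Params p) p.K k s'.init U *
              tkBranchOfRecord F N (FluctV N) θ.ν θ.τ9.M (gOfRecord₁₃ F N θ.toStage13Params p) p.K (WtOfRecord₁₃H F N θ p s'.init) s'.init S₀ k
                (fun ω => (sect2Operand F N (FluctV N) p.K (settingOfRecord₁₃ F N θ.toStage13Params p) (θ.rzAt p s'.init) s'.init ((chainWitness θ p σ k).1 s'.init) ((chainWitness θ p σ k).2 s'.init)
            (UbgOfRecord₁₃CoP F N θ.toStage13Params p k s'.init)) (S₀, fun j => (ω j).2) (fun j => (ω j).1)) (baseCfg k U))) ∘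
          ⇑(MeasurableEquiv.piEquivPiSubtypeProd (fun _ : PBond (F.P p.K) k => SU N)
            (· ∈ (Set.toFinite (bondsIn k (s'.Ω (k + 1))ᶜ)).toFinset)).symm)
      =ᵐ[((Measure.pi fun _ : ↥(Set.toFinite (bondsIn k (s'.Ω (k + 1))ᶜ)).toFinset => (HaarData.haar : Measure (SU N))).prod
          (Measure.pi fun _ : {c : PBond (F.P p.K) (k + 1) // c ∉ (Set.toFinite (bondsIn (k + 1) (s'.Ω (k + 1))ᶜ)).toFinset} =>
            (HaarData.haar : Measure (SU N))))] Fᵢ₀ S₀)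
    (hinner₀ : ∀ᵐ q ∂((Measure.pi fun _ : ↥(Set.toFinite (bondsIn (k + 1) (s'.Ω (k + 1))ᶜ)).toFinset => (HaarData.haar : Measure (SU N))).prod
          (Measure.pi fun _ : {c : PBond (F.P p.K) (k + 1) // c ∉ (Set.toFinite (bondsIn (k + 1) (s'.Ω (k + 1))ᶜ)).toFinset} =>
            (HaarData.haar : Measure (SU N)))),
      ∀ S₀ ∈ admSOfRecord F θ.ν θ.τ9.M (gOfRecord₁₃ F N θ.toStage13Params p) p.K k s'.init, ∀ y : ↥(Set.toFinite (bondsIn k (s'.Ω (k + 1))ᶜ)).toFinset → SU N,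
        avgRestrOfRecord F N p.K k (Set.toFinite (bondsIn k (s'.Ω (k + 1))ᶜ)).toFinset (Set.toFinite (bondsIn (k + 1) (s'.Ω (k + 1))ᶜ)).toFinset y = q.1 →
        Fᵢ₀ S₀ (y, q.2) =
          ∑ Y ∈ (Set.toFinite {Y : Set (Site (F.P p.K) 0) | Y ∈ SClassOfRecord F θ.ν (gOfRecord₁₃ F N θ.toStage13Params p) p.K (k + 1) ∧ Y ⊆ s'.Ω (k + 1) ∩ (s'.Λ (k + 1))ᶜ}).toFinset,
            zetaOp (genDataOfRecord F N (FluctV N) θ.ν θ.τ9.M (gOfRecord₁₃ F N θ.toStage13Params p) p.K (WtOfRecord₁₃H F N θ p s') s' (Function.update S₀ (k + 1) Y) k).ζ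
              (aOp k (genDataOfRecord F N (FluctV N) θ.ν θ.τ9.M (gOfRecord₁₃ F N θ.toStage13Params p) p.K (WtOfRecord₁₃H F N θ p s') s' (Function.update S₀ (k + 1) Y) k).sA
                (genDataOfRecord F N (FluctV N) θ.ν θ.τ9.M (gOfRecord₁₃ F N θ.toStage13Params p) p.K (WtOfRecord₁₃H F N θ p s') s' (Function.update S₀ (k + 1) Y) k).w
                (tkBranchOfRecord F N (FluctV N) θ.ν θ.τ9.M (gOfRecord₁₃ F N θ.toStage13Params p) p.K (WtOfRecord₁₃H F N θ p s') s'.init S₀ k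
                  (fun ω => (sect2Operand F N (FluctV N) p.K (settingOfRecord₁₃ F N θ.toStage13Params p) (θ.rzAt p s') s' (graftAboveB k ((chainWitness θ p σ k).1 s'.init) ((σ k (chainWitness θ p σ k).1 (chainWitness θ p σ k).2).1 s')) ((σ k (chainWitness θ p σ k).1 (chainWitness θ p σ k).2).2 s')
                  (UbgOfRecord₁₃CoP F N θ.toStage13Params p (k + 1) s')) (Function.update S₀ (k + 1) Y, fun j => (ω j).2) (fun j => (ω j).1))))
              (Function.update (baseCfg (k + 1) ((MeasurableEquiv.piEquivPiSubtypeProd (fun _ : PBond (F.P p.K) (k + 1) => SU N)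
                (· ∈ (Set.toFinite (bondsIn (k + 1) (s'.Ω (k + 1))ᶜ)).toFinset)).symm q)) k
              (Function.updateFinset ((baseCfg (V := FluctV N) (k + 1) ((MeasurableEquiv.piEquivPiSubtypeProd (fun _ : PBond (F.P p.K) (k + 1) => SU N)
                (· ∈ (Set.toFinite (bondsIn (k + 1) (s'.Ω (k + 1))ᶜ)).toFinset)).symm q)) k).1 (Set.toFinite (bondsIn k (s'.Ω (k + 1))ᶜ)).toFinset y,
                ((baseCfg (V := FluctV N) (k + 1) ((MeasurableEquiv.piEquivPiSubtypeProd (fun _ : PBond (F.P p.K) (k + 1) => SU N)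
                (· ∈ (Set.toFinite (bondsIn (k + 1) (s'.Ω (k + 1))ᶜ)).toFinset)).symm q)) k).2))) :
    slotsTOfRecord F N θ.ν θ.τ9 (EOfRecord₁₃ F N θ.toStage13Params) (wOfRecord₉ F N θ.toStage9Params) θ.ppSel p (gOfRecord₁₃ F N θ.toStage13Params p) (k + 1) s' = 0 ∨
      ∀ᵐ V' ∂fieldMeasure (F.P p.K) (k + 1) (SU N),
        chiSeqOfRecord F N θ.ν θ.τ9.M (gOfRecord₁₃ F N θ.toStage13Params p) p.K (k + 1) s' V' ≠ 0 →
          slotsTOfRecord F N θ.ν θ.τ9 (EOfRecord₁₃ F N θ.toStage13Params) (wOfRecord₉ F N θ.toStage9Params) θ.ppSel p (gOfRecord₁₃ F N θ.toStage13Params p) (k + 1) s' V' =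
            sect2Slot F N (FluctV N) p.K (settingOfRecord₁₃ F N θ.toStage13Params p) (θ.rzAt p s') (WtOfRecord₁₃H F N θ p s') s' (graftAboveB k ((chainWitness θ p σ k).1 s'.init) ((σ k (chainWitness θ p σ k).1 (chainWitness θ p σ k).2).1 s')) ((σ k (chainWitness θ p σ k).1 (chainWitness θ p σ k).2).2 s')
              (UbgOfRecord₁₃CoP F N θ.toStage13Params p (k + 1) s') V' :=
  slotsTOfRecord₁₃H_succ_O3_of_hasSect2FormAtZS_of_oldBranchInnerSum_of_provisos_of_termRows θ h p hkK (hdec := hdec) (hdec' := hdec') hk s' hform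
    (graftAboveB k ((chainWitness θ p σ k).1 s'.init) ((σ k (chainWitness θ p σ k).1 (chainWitness θ p σ k).2).1 s')) ((σ k (chainWitness θ p σ k).1 (chainWitness θ p σ k).2).2 s') hζ0m hqm hζm hqm'
    (fun j h1 hj => termRowsAt_chainWitness_of_supplierTermRows hσ k s'.init j h1 hj)
    (fun j h1 _ => termRowsAt_graftAboveB k _ _ j (fun hjk => termRowsAt_chainWitness_of_supplierTermRows hσ k s'.init j h1 hjk) fun _ => hσ k s' j h1)
    Fᵢ₀ hFm₀ hin₀ hinner₀

/-! ## §2  At the re-pinned parameter `rePinH θ`: no residual-measurability row -/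

/-- ★★★★★★ **THE (O3′) CLAUSE AT A 𝐓-PRESENT CHILD OF THE CHAIN AT `rePinH θ`** — from `θ.Provisos₁₃CoPH F N`, `ChainFormAt (rePinH θ) p σ k`, `SupplierTermRows (rePinH θ) p σ`
and the chart-side data ONLY (`…TStepOldBranchInnerSumAtRePinH` §2 with the same term-row feeds).
[cite: Balaban1988Convergent, Thm 1 p.262, Thm 2 p.263, §3 p.279, (3.24)–(3.25) p.270; Balaban1989LargeFieldI, (0.2)–(0.3) p.176] -/
theorem O3_presentChild_rePinH_of_chainFormAt_of_supplierTermRows (θ : Stage13HParams F N) (h : θ.Provisos₁₃CoPH F N)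
    (p : B12.RunParams) {k : ℕ} (hkK : k < p.K)
    {hdec : DecidableEq (PBond (F.P p.K) k)} {hdec' : DecidableEq (PBond (F.P p.K) (k + 1))} (hk : k + 1 ≤ (F.P p.K).m + (F.P p.K).K)
    -- the supplier, Theorem 1's level-`k` form of its chain (dag-n11-e's `ChainFormAt`), its term rows (dag-n11-w3's `SupplierTermRows`), the child `s′`
    (σ : Sect3Supplier (rePinH θ) p) (hform : ChainFormAt (rePinH θ) p σ k) (hσ : SupplierTermRows (rePinH θ) p σ)
    (s' : SeqOfRecord F (rePinH θ).ν (rePinH θ).τ9.M (gOfRecord₁₃ F N (rePinH θ).toStage13Params p) p.K (k + 1))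
    (Fᵢ₀ : (ℕ → Set (Site (F.P p.K) 0)) → (↥(Set.toFinite (bondsIn k (s'.Ω (k + 1))ᶜ)).toFinset → SU N) ×
        ({c : PBond (F.P p.K) (k + 1) // c ∉ (Set.toFinite (bondsIn (k + 1) (s'.Ω (k + 1))ᶜ)).toFinset} → SU N) → ℝ)
    (hFm₀ : ∀ S₀ ∈ admSOfRecord F (rePinH θ).ν (rePinH θ).τ9.M (gOfRecord₁₃ F N (rePinH θ).toStage13Params p) p.K k s'.init, Measurable (Fᵢ₀ S₀))
    (hin₀ : ∀ S₀ ∈ admSOfRecord F (rePinH θ).ν (rePinH θ).τ9.M (gOfRecord₁₃ F N (rePinH θ).toStage13Params p) p.K k s'.init, kernelTransport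
        ((Measure.pi fun _ : ↥(Set.toFinite (bondsIn k (s'.Ω (k + 1))ᶜ)).toFinset => (HaarData.haar : Measure (SU N))).prod
          (Measure.pi fun _ : {b : PBond (F.P p.K) k // b ∉ (Set.toFinite (bondsIn k (s'.Ω (k + 1))ᶜ)).toFinset} => (HaarData.haar : Measure (SU N))))
        ((Measure.pi fun _ : ↥(Set.toFinite (bondsIn k (s'.Ω (k + 1))ᶜ)).toFinset => (HaarData.haar : Measure (SU N))).prod
          (Measure.pi fun _ : {c : PBond (F.P p.K) (k + 1) // c ∉ (Set.toFinite (bondsIn (k + 1) (s'.Ω (k + 1))ᶜ)).toFinset} =>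
            (HaarData.haar : Measure (SU N))))
        (fun q => (q.1, fun c : {c : PBond (F.P p.K) (k + 1) // c ∉ (Set.toFinite (bondsIn (k + 1) (s'.Ω (k + 1))ᶜ)).toFinset} =>
          (avOfRecord F N p.K k).avg
            ((MeasurableEquiv.piEquivPiSubtypeProd (fun _ : PBond (F.P p.K) k => SU N)
              (· ∈ (Set.toFinite (bondsIn k (s'.Ω (k + 1))ᶜ)).toFinset)).symm q) c))
        ((fun U => wOfRecord₉ F N (rePinH θ).toStage9Params p (gOfRecord₁₃ F N (rePinH θ).toStage13Params p) k s' U ((avOfRecord F N p.K k).avg U) *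
            (chiSeqOfRecord F N (rePinH θ).ν (rePinH θ).τ9.M (gOfRecord₁₃ F N (rePinH θ).toStage13Params p) p.K k s'.init U *
              tkBranchOfRecord F N (FluctV N) (rePinH θ).ν (rePinH θ).τ9.M (gOfRecord₁₃ F N (rePinH θ).toStage13Params p) p.K (WtOfRecord₁₃H F N (rePinH θ) p s'.init) s'.init S₀ k
                (fun ω => (sect2Operand F N (FluctV N) p.K (settingOfRecord₁₃ F N (rePinH θ).toStage13Params p) ((rePinH θ).rzAt p s'.init) s'.init ((chainWitness (rePinH θ) p σ k).1 s'.init) ((chainWitness (rePinH θ) p σ k).2 s'.init)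
            (UbgOfRecord₁₃CoP F N (rePinH θ).toStage13Params p k s'.init)) (S₀, fun j => (ω j).2) (fun j => (ω j).1)) (baseCfg k U))) ∘
          ⇑(MeasurableEquiv.piEquivPiSubtypeProd (fun _ : PBond (F.P p.K) k => SU N)
            (· ∈ (Set.toFinite (bondsIn k (s'.Ω (k + 1))ᶜ)).toFinset)).symm)
      =ᵐ[((Measure.pi fun _ : ↥(Set.toFinite (bondsIn k (s'.Ω (k + 1))ᶜ)).toFinset => (HaarData.haar : Measure (SU N))).prod
          (Measure.pi fun _ : {c : PBond (F.P p.K) (k + 1) // c ∉ (Set.toFinite (bondsIn (k + 1) (s'.Ω (k + 1))ᶜ)).toFinset} =>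
            (HaarData.haar : Measure (SU N))))] Fᵢ₀ S₀)
    (hinner₀ : ∀ᵐ q ∂((Measure.pi fun _ : ↥(Set.toFinite (bondsIn (k + 1) (s'.Ω (k + 1))ᶜ)).toFinset => (HaarData.haar : Measure (SU N))).prod
          (Measure.pi fun _ : {c : PBond (F.P p.K) (k + 1) // c ∉ (Set.toFinite (bondsIn (k + 1) (s'.Ω (k + 1))ᶜ)).toFinset} =>
            (HaarData.haar : Measure (SU N)))),
      ∀ S₀ ∈ admSOfRecord F (rePinH θ).ν (rePinH θ).τ9.M (gOfRecord₁₃ F N (rePinH θ).toStage13Params p) p.K k s'.init, ∀ y : ↥(Set.toFinite (bondsIn k (s'.Ω (k + 1))ᶜ)).toFinset → SU N,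
        avgRestrOfRecord F N p.K k (Set.toFinite (bondsIn k (s'.Ω (k + 1))ᶜ)).toFinset (Set.toFinite (bondsIn (k + 1) (s'.Ω (k + 1))ᶜ)).toFinset y = q.1 →
        Fᵢ₀ S₀ (y, q.2) =
          ∑ Y ∈ (Set.toFinite {Y : Set (Site (F.P p.K) 0) | Y ∈ SClassOfRecord F (rePinH θ).ν (gOfRecord₁₃ F N (rePinH θ).toStage13Params p) p.K (k + 1) ∧ Y ⊆ s'.Ω (k + 1) ∩ (s'.Λ (k + 1))ᶜ}).toFinset,
            zetaOp (genDataOfRecord F N (FluctV N) (rePinH θ).ν (rePinH θ).τ9.M (gOfRecord₁₃ F N (rePinH θ).toStage13Params p) p.K (WtOfRecord₁₃H F N (rePinH θ) p s') s' (Function.update S₀ (k + 1) Y) k).ζ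
              (aOp k (genDataOfRecord F N (FluctV N) (rePinH θ).ν (rePinH θ).τ9.M (gOfRecord₁₃ F N (rePinH θ).toStage13Params p) p.K (WtOfRecord₁₃H F N (rePinH θ) p s') s' (Function.update S₀ (k + 1) Y) k).sA
                (genDataOfRecord F N (FluctV N) (rePinH θ).ν (rePinH θ).τ9.M (gOfRecord₁₃ F N (rePinH θ).toStage13Params p) p.K (WtOfRecord₁₃H F N (rePinH θ) p s') s' (Function.update S₀ (k + 1) Y) k).w
                (tkBranchOfRecord F N (FluctV N) (rePinH θ).ν (rePinH θ).τ9.M (gOfRecord₁₃ F N (rePinH θ).toStage13Params p) p.K (WtOfRecord₁₃H F N (rePinH θ) p s') s'.init S₀ k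
                  (fun ω => (sect2Operand F N (FluctV N) p.K (settingOfRecord₁₃ F N (rePinH θ).toStage13Params p) ((rePinH θ).rzAt p s') s' (graftAboveB k ((chainWitness (rePinH θ) p σ k).1 s'.init) ((σ k (chainWitness (rePinH θ) p σ k).1 (chainWitness (rePinH θ) p σ k).2).1 s')) ((σ k (chainWitness (rePinH θ) p σ k).1 (chainWitness (rePinH θ) p σ k).2).2 s')
                  (UbgOfRecord₁₃CoP F N (rePinH θ).toStage13Params p (k + 1) s')) (Function.update S₀ (k + 1) Y, fun j => (ω j).2) (fun j => (ω j).1))))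
              (Function.update (baseCfg (k + 1) ((MeasurableEquiv.piEquivPiSubtypeProd (fun _ : PBond (F.P p.K) (k + 1) => SU N)
                (· ∈ (Set.toFinite (bondsIn (k + 1) (s'.Ω (k + 1))ᶜ)).toFinset)).symm q)) k
              (Function.updateFinset ((baseCfg (V := FluctV N) (k + 1) ((MeasurableEquiv.piEquivPiSubtypeProd (fun _ : PBond (F.P p.K) (k + 1) => SU N)
                (· ∈ (Set.toFinite (bondsIn (k + 1) (s'.Ω (k + 1))ᶜ)).toFinset)).symm q)) k).1 (Set.toFinite (bondsIn k (s'.Ω (k + 1))ᶜ)).toFinset y,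
                ((baseCfg (V := FluctV N) (k + 1) ((MeasurableEquiv.piEquivPiSubtypeProd (fun _ : PBond (F.P p.K) (k + 1) => SU N)
                (· ∈ (Set.toFinite (bondsIn (k + 1) (s'.Ω (k + 1))ᶜ)).toFinset)).symm q)) k).2))) :
    slotsTOfRecord F N (rePinH θ).ν (rePinH θ).τ9 (EOfRecord₁₃ F N (rePinH θ).toStage13Params) (wOfRecord₉ F N (rePinH θ).toStage9Params) (rePinH θ).ppSel p (gOfRecord₁₃ F N (rePinH θ).toStage13Params p) (k + 1) s' = 0 ∨
      ∀ᵐ V' ∂fieldMeasure (F.P p.K) (k + 1) (SU N),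
        chiSeqOfRecord F N (rePinH θ).ν (rePinH θ).τ9.M (gOfRecord₁₃ F N (rePinH θ).toStage13Params p) p.K (k + 1) s' V' ≠ 0 →
          slotsTOfRecord F N (rePinH θ).ν (rePinH θ).τ9 (EOfRecord₁₃ F N (rePinH θ).toStage13Params) (wOfRecord₉ F N (rePinH θ).toStage9Params) (rePinH θ).ppSel p (gOfRecord₁₃ F N (rePinH θ).toStage13Params p) (k + 1) s' V' =
            sect2Slot F N (FluctV N) p.K (settingOfRecord₁₃ F N (rePinH θ).toStage13Params p) ((rePinH θ).rzAt p s') (WtOfRecord₁₃H F N (rePinH θ) p s') s' (graftAboveB k ((chainWitness (rePinH θ) p σ k).1 s'.init) ((σ k (chainWitness (rePinH θ) p σ k).1 (chainWitness (rePinH θ) p σ k).2).1 s')) ((σ k (chainWitness (rePinH θ) p σ k).1 (chainWitness (rePinH θ) p σ k).2).2 s')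
              (UbgOfRecord₁₃CoP F N (rePinH θ).toStage13Params p (k + 1) s') V' :=
  slotsTOfRecord₁₃H_succ_O3_of_hasSect2FormAtZS_of_oldBranchInnerSum_rePinH_of_termRows θ h p hkK (hdec := hdec) (hdec' := hdec') hk s' hform
    (graftAboveB k ((chainWitness (rePinH θ) p σ k).1 s'.init) ((σ k (chainWitness (rePinH θ) p σ k).1 (chainWitness (rePinH θ) p σ k).2).1 s')) ((σ k (chainWitness (rePinH θ) p σ k).1 (chainWitness (rePinH θ) p σ k).2).2 s')
    (fun j h1 hj => termRowsAt_chainWitness_of_supplierTermRows hσ k s'.init j h1 hj)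
    (fun j h1 _ => termRowsAt_graftAboveB k _ _ j (fun hjk => termRowsAt_chainWitness_of_supplierTermRows hσ k s'.init j h1 hjk) fun _ => hσ k s' j h1)
    Fᵢ₀ hFm₀ hin₀ hinner₀

end Summit.QuantumFields.YangMills.Theorems.BalabanUVNodesN11O3OfSupplierTermRows

end
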